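import Summits.HodgeConjecture.HodgeConjecture.Theses.EndoscopicMiddleDegree
import Summits.HodgeConjecture.HodgeConjecture.Theorems.BallQuotientHodgeAbsolute.Negative.ChartConjugationUniqueness
import Literature.AlgebraicGeometry.ShimuraVarieties.HeckeCorrespondenceAction
import Literature.AlgebraicGeometry.HodgeTheory.ComplexConjugation

/-!
# Line `reflex-descent-conjugation-cocycle` — skeleton for crux `EndoscopicMiddleDegree.BallQuotientHodgeAbsolute`
(item stmt-HodgeConjecture-14348, route route-HodgeConjecture-EndoscopicMiddleDegree; crux-plan round 1 of idea
card `Cruxes/BallQuotientHodgeAbsolute/Ideas/reflex-descent-conjugation-cocycle.md`; triage r1-1, r1-2, r1-3: **pass**,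
"merge with cup-period-bootstrap", sharpening X2 of all three triagers built in below;
planner-cruxplan-stmt-HodgeConjecture-14348-reflex-descent-conju-0, 2026-08-16)

## The crux (verbatim, rank 3 of route EndoscopicMiddleDegree; `m` UNRESTRICTED)

  `BallQuotientHodgeAbsolute := ∀ (m : ℕ) (X : SchemeOver ℂ), Nonempty (UnitaryBallQuotientDatum (2(m+1)) X) →
     ∀ c : H^{2(m+1)}(X(ℂ); ℂ), IsRationalClass c → IsOfHodgeType (2(m+1)) X (2(m+1)) (m+1) (m+1) c →
       IsAbsoluteHodgeClass (2(m+1)) X (m+1) c`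

i.e. (Disproof.lean §1, `iff_conjugationClause`) the bare de Rham CONJUGATION CLAUSE for rational middle
`(n,n)`-classes, `n = m + 1`, on even-dimensional compact arithmetic ball quotients `X(ℂ) ≅ Γ\𝔹²ⁿ`: for every
`σ ∈ Aut ℂ` a conjugate `c^σ ∈ H²ⁿ(X^σ(ℂ); ℂ)` exists and every conjugate is `(2πi/σ(2πi))ⁿ · β`, `β` rational
of type `(n,n)` on `X^σ`.

## The line in one paragraph (card (F)(P)(C) + triage X2 "Schur + polarisation")

Decompose `H := H²ⁿ(X(ℂ); ℂ)` under the RATIONAL Hecke algebra of `Γ` into its `ℚ`-isotypic blocks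
`N = eᵢ H` (Matsushima / BMM Thm 61). The Hecke operators are the tree's GENUINE ones,
`T_g = D.heckeCorrespondenceAction (2n) g` (`ShimuraVarieties/HeckeCorrespondenceAction`, landed 2026-08-16: transfer ∘
pull-back on the level-`N_g` cover, rationality `isRationalClass_heckeCorrespondenceAction` PROVED); the `ℚ`-algebra they
generate (`InHeckeAlgebra`, an inductive predicate, shape shared with the sibling lines `lefschetz-one-rank-down` and
`hecke-simple-seed-amplification`) preserves rational classes (`InHeckeAlgebra.isRationalClass_apply`, PROVED below), and its
central primitive idempotents are THE rational blocks (`IsRationalBlocks`, Stub 2). A rational `(n,n)`-class `c` is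
`Σᵢ eᵢ c`, each `eᵢ c` rational of type `(n,n)`.
THE conjugation `θ_σ : Hᵏ(X) → Hᵏ(X^σ)` of Charles–Schnell §11.2.2 is a `σ`-semilinear multiplicative bijection
computing `IsConjugateClass` (`ConjugationOperator`, Stub 1 — exactly the chart existence + single-valuedness that
Disproof.lean §6–§8 shows ANY proof must certify). REFLEX DESCENT (Stub 3, card (F)): `X` has a model over a
number field `K` (canonical model of the connected component: a finite abelian extension of the reflex field,
enlarged once more, finitely, so that the finitely many generators of the finite-dimensional rational Hecke
algebra descend); for `σ ∈ Aut(ℂ/K)` this gives `φ_σ : X^σ ≅ X`, and the INNER conjugation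
`ι_σ := (φ_σ^*)⁻¹ ∘ θ_σ` (= `1 ⊗ σ` on `H_dR(X₀/K) ⊗_K ℂ`) commutes with the Hecke operators and multiplies the
rational top class by EXACTLY `(2πi/σ(2πi))²ⁿ` (the de Rham class of a `K`-rational zero-cycle is `K`-rational;
the Betti point class is `(2πi)^{-2n}` times it). SCHUR (Stub 4, the lever, provable now in print): on a block
`N` that is PURE (`N ⊂ H^{n,n}`) and Hecke-SIMPLE (`T = ℚ`, multiplicity one) the `ℂ`-linear Hecke-commuting map
`L_σ := ι_σ ∘ (1 ⊗ σ)⁻¹` is a scalar `a_σ` (Schur), `ι_σ c = a_σ c` for RATIONAL `c`, and the polarisation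
(`c₁ ∪ c₁ = Q(c₁,c₁)·[pt]`, `Q(c₁,c₁) ∈ ℚˣ` for some `c₁ ∈ N_ℚ`, `θ` multiplicative, top class twisted by
`t_{2n} = t_n²`) gives `a_σ² = t_n²`: **`c^σ = ± t_n · φ_σ^* c` for every rational `c ∈ N` and every
`σ ∈ Aut(ℂ/K)`** — the inner conjugation clause HOLDS on such blocks, no cycle, no period, no seed. OUTER
`σ ∉ Aut(ℂ/K)` (finitely many classes `σ|_K`; Stub 5, BET 1): Noether–Deuring + Schur give `c^σ = μ_σ ψ₀(c)`,
`ψ₀ : N_ℚ ≅ N'_ℚ ⊂ H²ⁿ(X^σ, ℚ)` the rational Hecke intertwiner onto the conjugate block, and duality pins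
`μ_σ² ∈ t_n² ℚˣ` (weakly absolute Hodge for free); absoluteness ⟺ ONE SQUARE CLASS `r_σ(N) ∈ ℚˣ/ℚˣ²` is trivial
(then `ψ := ±√r ψ₀` is the rational map of Stub 5). RESIDUE (Stub 6, BET 2 = the residue shared by all eight
cards of the panel): blocks that are not Schur blocks — impure blocks (killed ones carry no rational
`(n,n)`-component by the conjugate-dimension sieve; CORES = balanced constituents of rank `≥ 2`, where
absoluteness ⟺ non-existence of rational `(n,n)`-classes, HC-counterexample territory) and pure non-simple
blocks (Hecke field `T ≠ ℚ` / multiplicity: the conjugation cocycle lives in the norm-one torus of the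
commutant, card (C); for totally real `T` with multiplicity one it is a finite sign cocycle, trivialised by a
finite extension of `K`, after which the inner argument of Stub 4 applies verbatim).

* `stub_conjugationOperator` (KNOWN in print; Jouanolou + GAGA + de Rham + Grothendieck comparison; formal blocker
  named by Disproof §6–§8): THE conjugation operator exists for smooth projective `X`, and the `(p,q)`-classes of
  the (smooth projective) conjugate `X^σ` form subspaces.
* `stub_heckeBlocks` (KNOWN in print; size M–L): the `ℚ`-algebra generated by the `T_g` on `H²ⁿ` has central primitive
  idempotents summing to `1` which respect Hodge types (`IsRationalBlocks`; Matsushima + BMM Thm 61).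
* `stub_reflexDescent` (KNOWN in print: canonical models + reciprocity; size L–XL): a number field `K` and a
  `DescentDatum` (`φ_σ`, Hecke compatibility, exact top twist, Hodge types transported).
* `stub_innerSchur` (THE LEVER; provable now from Stubs 1–3 + Schur + Hodge–Riemann; size L): Schur blocks,
  `σ ∈ Aut(ℂ/K)`: `θ_σ c = t_n · (ε φ_σ^* c)`, `ε = ±1` uniform on the block.
* `stub_outerSquareClass` (BET 1, open; weak form provable): Schur blocks, `σ ∉ Aut(ℂ/K)`: a rational,
  type-preserving `ψ_σ` with `θ_σ = t_n ψ_σ` on `N_ℚ`.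
* `stub_residualBlocks` (BET 2, HARDEST; the shared residue): non-Schur blocks: conjugates of the components of
  rational `(n,n)`-classes are `t_n ·` rational `(n,n)`-classes.
* `BallQuotientHodgeAbsolute_of` — the kernel-checked composition: existence of the conjugate from Stub 1;
  uniqueness reduces the clause to `θ_σ c`; `c = Σᵢ eᵢ c` (Stub 2); per block: Schur & inner ⇒ Stub 4
  (`β = ε φ_σ^*(eᵢ c)`, rational since `φ_σ` is an isomorphism of complex varieties, `(n,n)` by the descent
  datum), Schur & outer ⇒ Stub 5, else Stub 6; sum the `βᵢ` (rational classes add; `(n,n)`-classes on `X^σ`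
  form a subspace by Stub 1; `θ_σ` is additive).

## Disproof.lean used (cdisprove cycles 1–2, NO KILL; landed Negative/HodgeImpliesAbsoluteHodge.lean p73087 and
Negative/ChartConjugationUniqueness.lean, both IMPORTED here)

No `_false_without_<H>` theorem, no tightness lemma, no refuted strengthening exists, so no stub can instantiate one.
Honoured: §1 — the skeleton decomposes exactly the conjugation clause (`isAbsoluteHodgeClass` unfolded in
`BallQuotientHodgeAbsolute_of`); §4 — RATIONALITY is load-bearing and is consumed visibly: Stub 4 speaks of
rational classes of the block only (`ι_σ c = L_σ c` needs `(1⊗σ) c = c`), Stubs 5–6 likewise, and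
`IsRationalBlocks.rational` (PROVED from the tree's `isRationalClass_heckeCorrespondenceAction`) feeds them; HODGE TYPE is load-bearing through the label `IsSchurBlock` (purity)
and Stub 6's `typePart` hypothesis; the DATUM is proof-side only (§4 "no field is load-bearing for truth"): it pins
the Hecke operators (Stub 2) and the canonical model (Stub 3); §6–§8 — chart existence and SINGLE-VALUEDNESS are
isolated as Stub 1 (`ConjugationOperator.conjugates_iff`), and `chart_singleValued_of_conjugationOperator` below
derives from Stub 1's structure precisely the Grothendieck fragment `conjugates of 0 are 0` that §8
(`conjugates_zero_eq_zero_of_ballQuotientHodgeAbsolute`) proves the crux must certify — the kill shapes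
`not_ballQuotientHodgeAbsolute_of_multivalued_chart` / `_of_two_conjugates` need a multivalued chart, which Stub 1
denies, so no stub is an instance of a landed Negative lemma (consistency, not contradiction: the Negative lemmas
are implications FROM multivaluedness); §5 `weakly_of` — Stub 5's docstring records that its WEAK form (`μ_σ²`
rational) is provable, the crux direction reversed; §9 — this line proves DE RHAM absoluteness only (the typed
predicate); the étale component (card (G), Kisin–Shin–Zhu) is not claimed; §11 (period reformulation) — on Schur
blocks and inner `σ` the period matrix cocycle `P⁻¹σ(P)` is the Schur scalar `a_σ = ±t_n`, which is why no
transcendence input is needed there; §3 — level `m = 0` is uniform here (no special casing; Stub 6 at `m = 0`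
follows in print from Lefschetz (1,1) + cycle classes absolute Hodge, `level_zero_of_lefschetz`).
Negatives index (`ledger negatives --problem HodgeConjecture`: ELineTransport stmt-12555, Fermat-K3 stmt-11121):
unrelated shapes. Barrier `Literature.Barriers.HodgeConjecture.ConjugateVarieties`
(`Serre1964_…notHomeomorphic`, `Charles2009_…cohomologyAlgebrasNotIso`): `θ_σ` is `σ`-SEMILINEAR over `ℂ` and
no rational lattice is transported along it; `φ_σ : X^σ ≅ X` is used only for `σ` FIXING a field of definition
(where the conjugate IS isomorphic as a scheme over `ℂ`); Stub 5's `ψ_σ` is a degree-`2n`, block-local linear map,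
not an algebra isomorphism. Barrier `AbsoluteHodgeClasses` (Deligne: abelian varieties only): not invoked —
Principle B is replaced by Shimura reciprocity (Stub 3) + Schur (Stub 4).
-/

noncomputable section

open scoped BigOperators ComplexOrder
open Matrix

set_option linter.dupNamespace false
set_option linter.unusedVariables false

namespace Summit.HodgeConjecture.HodgeConjecture.Cruxes.BallQuotientHodgeAbsolute.ReflexDescentConjugationCocycle

open Literature.AlgebraicGeometry.Motives (SchemeOver ComplexPoints IsSmoothProjective conjugateVariety)
open Literature.AlgebraicGeometry.HodgeTheory
open Literature.AlgebraicGeometry.ShimuraVarieties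
open Literature.AlgebraicTopology.SingularHomology


/-! ## Hecke vocabulary over the tree's genuine operators `D.heckeCorrespondenceAction k g` -/

section Hecke

variable {p : ℕ} {X : SchemeOver ℂ} (D : UnitaryBallQuotientDatum p X)

/-- The `(a,b)`-type subspace of `Hᵏ(X(ℂ); ℂ)` cut out by a Hodge model `A` (pull-back of `A.hodgePQ`); `IsOfHodgeType p X k a b x`
is literally `∃ A, x ∈ typePart A k a b`. (Same three lines as in the sibling lines of the route.) -/
def typePart (A : HodgeModel p X) (k a b : ℕ) : Submodule ℂ (complexBetti X k) :=
  (A.hodgePQ k a b).comap (A.pullback k).hom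

theorem mem_typePart_iff (A : HodgeModel p X) (k a b : ℕ) (x : complexBetti X k) :
    x ∈ typePart A k a b ↔ A.pullback k x ∈ A.hodgePQ k a b :=
  Iff.rfl

/-- Membership in the **rational Hecke algebra** of degree `k`: the `ℚ`-subalgebra of `End_ℂ Hᵏ(X(ℂ); ℂ)` generated by the
Hecke operators `T_g = D.heckeCorrespondenceAction k g` (the image of `ℋ(U(V)(F), Γ) ⊗ ℚ`; junk `T_g = 0` for inadmissible `g`
changes nothing), as an inductive predicate (no `Algebra ℚ (Module.End ℂ _)` instance needed).
[BMM arXiv:1306.1515 Part 2 §1.8–1.9] -/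
inductive InHeckeAlgebra (k : ℕ) : Module.End ℂ (complexBetti X k) → Prop
  | gen (g : GL (Fin (p + 1)) D.E) : InHeckeAlgebra k (D.heckeCorrespondenceAction k g)
  | one : InHeckeAlgebra k 1
  | add {f f' : Module.End ℂ (complexBetti X k)} :
      InHeckeAlgebra k f → InHeckeAlgebra k f' → InHeckeAlgebra k (f + f')
  | mul {f f' : Module.End ℂ (complexBetti X k)} :
      InHeckeAlgebra k f → InHeckeAlgebra k f' → InHeckeAlgebra k (f * f')
  | smul (q : ℚ) {f : Module.End ℂ (complexBetti X k)} : InHeckeAlgebra k f → InHeckeAlgebra k ((q : ℂ) • f)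

variable {D} in
/-- **The rational Hecke algebra preserves rational classes** (PROVED: generators by the tree's
`isRationalClass_heckeCorrespondenceAction`, then induction) — so the rational blocks below are honestly rational. -/
theorem InHeckeAlgebra.isRationalClass_apply {k : ℕ} {f : Module.End ℂ (complexBetti X k)}
    (hf : InHeckeAlgebra D k f) {x : complexBetti X k} (hx : IsRationalClass x) : IsRationalClass (f x) := by
  induction hf generalizing x with
  | gen g => exact D.isRationalClass_heckeCorrespondenceAction k g hx
  | one => simpa using hx
  | add _ _ ih ih' => simpa using (ih hx).add (ih' hx)
  | mul _ _ ih ih' => simpa using ih (ih' hx)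
  | smul q _ ih => simpa using (ih hx).smul q

/-- `e` is THE finite family of **rational blocks** of `Hᵏ(X(ℂ); ℂ)`: the central primitive idempotents of the rational Hecke
algebra (unique up to relabelling) — the projectors onto the `ℚ`-isotypic pieces `W([π_f])^Γ ⊗ ℂ = ⊕_τ Hᵏ(τπ_f) ⊗ τπ_f^Γ` of
Matsushima's decomposition, i.e. the Galois-orbit blocks (BMM §1.8–1.9, Thm 61). They preserve rational classes
(`InHeckeAlgebra.isRationalClass_apply`); that they respect Hodge types (Hecke correspondences are algebraic, hence morphisms
of Hodge structures) is recorded as the last clause. -/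
structure IsRationalBlocks (k : ℕ) {ι : Type} [Fintype ι] (e : ι → Module.End ℂ (complexBetti X k)) : Prop where
  mem : ∀ i, InHeckeAlgebra D k (e i)
  idem : ∀ i, e i * e i = e i
  ortho : ∀ i j, i ≠ j → e i * e j = 0
  sum : ∑ i, e i = 1
  central : ∀ i (g : GL (Fin (p + 1)) D.E),
    e i * D.heckeCorrespondenceAction k g = D.heckeCorrespondenceAction k g * e i
  primitive : ∀ i (f : Module.End ℂ (complexBetti X k)), InHeckeAlgebra D k f →
    (∀ g : GL (Fin (p + 1)) D.E, f * D.heckeCorrespondenceAction k g = D.heckeCorrespondenceAction k g * f) →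
    f * f = f → f * e i = 0 ∨ f * e i = e i
  hodgeType : ∀ i (A : HodgeModel p X) (a b : ℕ), ∀ x ∈ typePart A k a b, e i x ∈ typePart A k a b

variable {D} in
/-- Rational blocks carry rational classes to rational classes. -/
theorem IsRationalBlocks.rational {k : ℕ} {ι : Type} [Fintype ι] {e : ι → Module.End ℂ (complexBetti X k)}
    (he : IsRationalBlocks D k e) (i : ι) {x : complexBetti X k} (hx : IsRationalClass x) : IsRationalClass (e i x) :=
  (he.mem i).isRationalClass_apply hx

end Hecke

/-! ## Conjugation vocabulary of this line -/

section Conjugation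

variable {p : ℕ} {X : SchemeOver ℂ}

/-- **THE conjugation operator** of `(σ, X)` (Charles–Schnell §11.2.2, `α ↦ α^σ` read in singular cohomology):
for every degree `k` a `σ`-SEMILINEAR map `θ_k : Hᵏ(X(ℂ); ℂ) → Hᵏ(X^σ(ℂ); ℂ)` which COMPUTES the tree's chart
relation — `c'` is a `σ`-conjugate of `c` iff `c' = θ c` (so charts exist for every class and are single-valued:
Jouanolou's affine torsor + GAGA + de Rham + Grothendieck's comparison, the blocker named in Disproof.lean §6–§8)
— is bijective, and is multiplicative for cup products (conjugation of algebraic de Rham cohomology is a ring map).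
There is at most one such operator (`θ c` is a conjugate of `c`, so a second operator agrees with it); it does
NOT respect the rational lattices (barrier `ConjugateVarieties`: Charles 2009) — whether it does on Hodge classes
is the crux. -/
structure ConjugationOperator (σ : ℂ ≃+* ℂ) (X : SchemeOver ℂ) where
  /-- `θ_k : Hᵏ(X(ℂ); ℂ) →ₛₗ[σ] Hᵏ(X^σ(ℂ); ℂ)`. -/
  θ : ∀ k : ℕ, complexBetti X k →ₛₗ[σ.toRingHom] complexBetti (conjugateVariety σ X) k
  /-- `θ` computes the chart conjugation relation of `AbsoluteHodgeClasses` (existence AND uniqueness). -/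
  conjugates_iff : ∀ (k : ℕ) (c : complexBetti X k) (c' : complexBetti (conjugateVariety σ X) k),
    IsConjugateClass σ X k c c' ↔ c' = θ k c
  /-- `θ_k` is a bijection (its inverse is the conjugation of `X^σ` by `σ⁻¹`, transported). -/
  bijective : ∀ k : ℕ, Function.Bijective (θ k)
  /-- `θ (a ∪ b) = θ a ∪ θ b`. -/
  map_cup : ∀ {i j k : ℕ} (h : i + j = k) (a : complexBetti X i) (b : complexBetti X j),
    θ k (cupProduct h a b) = cupProduct h (θ i a) (θ j b)

/-- Consistency with the landed Negative lemmas (Disproof.lean §8, `ChartConjugationUniqueness`): a conjugation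
operator makes EVERY chart single-valued — in particular every conjugate of `0` is `0`, the Grothendieck fragment
that `conjugates_zero_eq_zero_of_ballQuotientHodgeAbsolute` shows the crux itself certifies. So Stub 1 sits on the
side of the crux, and the kill shapes `not_ballQuotientHodgeAbsolute_of_multivalued_chart` /
`not_ballQuotientHodgeAbsolute_of_two_conjugates` (which need two distinct conjugates) cannot be instantiated from
any stub of this line. -/
theorem chart_singleValued_of_conjugationOperator {σ : ℂ ≃+* ℂ} (Θ : ConjugationOperator σ X) {k : ℕ}
    (Dc : ConjugationChart σ X k) {c : complexBetti X k} {c' c'' : complexBetti (conjugateVariety σ X) k}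
    (h' : Dc.Conjugates c c') (h'' : Dc.Conjugates c c'') : c' = c'' := by
  rw [(Θ.conjugates_iff k c c').1 ⟨Dc, h'⟩, (Θ.conjugates_iff k c c'').1 ⟨Dc, h''⟩]

/-- In particular the only conjugate of `0` in any chart is `0`. -/
theorem conjugates_zero_eq_zero_of_conjugationOperator {σ : ℂ ≃+* ℂ} (Θ : ConjugationOperator σ X) {k : ℕ}
    (Dc : ConjugationChart σ X k) {c' : complexBetti (conjugateVariety σ X) k} (h : Dc.Conjugates 0 c') :
    c' = 0 := by
  rw [(Θ.conjugates_iff k 0 c').1 ⟨Dc, h⟩, map_zero]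

variable {m : ℕ} (D : UnitaryBallQuotientDatum (2 * (m + 1)) X)

/-- **Reflex descent datum over `K ⊆ ℂ`** (card (F)): for every `σ ∈ Aut(ℂ/K)` an isomorphism of `ℂ`-schemes
`φ_σ : X^σ ≅ X` (from a model `X₀/K`: `X^σ = X₀ ⊗_K ℂ ⊗_{ℂ,σ} ℂ ≅ X₀ ⊗_K ℂ`, cf.
`nonempty_iso_conjugateVariety_baseChangeHom`) such that the INNER conjugation `ι_σ := (φ_σ^*)⁻¹ ∘ θ_σ` (which is
`1 ⊗ σ` on `H_dR(X₀/K) ⊗_K ℂ`)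
(i) commutes with the Hecke operators `T_{ΓgΓ}` in the middle degree (they are induced by algebraic
correspondences that descend to `X₀ ×_K X₀` — `K` is chosen large enough, see `stub_reflexDescent`);
(ii) multiplies every rational class of the TOP degree `4n` by exactly `periodTwist σ (2n) = (2πi/σ(2πi))²ⁿ` (the
Betti class of a point is `(2πi)^{-2n}` times the `K`-rational algebraic de Rham class of a `K`-rational zero-cycle
of degree one, and `1 ⊗ σ` fixes the latter);
(iii) `φ_σ^*` carries `(n,n)`-classes of `X` to `(n,n)`-classes of `X^σ` (an isomorphism of varieties transports
Hodge models). Fields (i)–(ii) quantify over every `ConjugationOperator` (there is exactly one). -/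
structure DescentDatum (K : Subfield ℂ) where
  /-- `φ_σ : X^σ ≅ X` for `σ` fixing `K` pointwise. -/
  iso : ∀ σ : ℂ ≃+* ℂ, (∀ x ∈ K, σ x = x) → (conjugateVariety σ X ≅ X)
  /-- (i) `ι_σ ∘ T_g = T_g ∘ ι_σ` on `H²ⁿ` for every `g` (`T_g = 0` junk for inadmissible `g` is harmless). -/
  hecke : ∀ (σ : ℂ ≃+* ℂ) (hσ : ∀ x ∈ K, σ x = x) (Θ : ConjugationOperator σ X)
    (g : GL (Fin (2 * (m + 1) + 1)) D.E) (c : complexBetti X (2 * (m + 1))),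
      complexBetti.map (iso σ hσ).inv (2 * (m + 1)) (Θ.θ (2 * (m + 1)) (D.heckeCorrespondenceAction (2 * (m + 1)) g c)) =
        D.heckeCorrespondenceAction (2 * (m + 1)) g
          (complexBetti.map (iso σ hσ).inv (2 * (m + 1)) (Θ.θ (2 * (m + 1)) c))
  /-- (ii) `ι_σ η = (2πi/σ(2πi))²ⁿ · η` for every rational top-degree class `η`. -/
  top : ∀ (σ : ℂ ≃+* ℂ) (hσ : ∀ x ∈ K, σ x = x) (Θ : ConjugationOperator σ X)
    (η : complexBetti X (2 * (2 * (m + 1)))), IsRationalClass η →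
      complexBetti.map (iso σ hσ).inv (2 * (2 * (m + 1))) (Θ.θ (2 * (2 * (m + 1))) η) =
        periodTwist σ (2 * (m + 1)) • η
  /-- (iii) `φ_σ^*` preserves the Hodge type `(n,n)` in the middle degree. -/
  hodgeType : ∀ (σ : ℂ ≃+* ℂ) (hσ : ∀ x ∈ K, σ x = x) (c : complexBetti X (2 * (m + 1))),
    IsOfHodgeType (2 * (m + 1)) X (2 * (m + 1)) (m + 1) (m + 1) c →
      IsOfHodgeType (2 * (m + 1)) (conjugateVariety σ X) (2 * (m + 1)) (m + 1) (m + 1)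
        (complexBetti.map (iso σ hσ).hom (2 * (m + 1)) c)

/-- **Schur block** (the SCOPE of the lever, read in a Hodge model `A`): a block `N ⊆ H²ⁿ(X(ℂ); ℂ)` that is
PURE — all of `N` is of type `(n,n)` (automorphically: `Σ(τπ_f) = {A(n×1, n×1)}` for every conjugate; a Tate-type
singleton packet with parallel `χ₀`) — and HECKE-SIMPLE — no proper non-zero subspace of `N` is stable under all
`T_{ΓgΓ}`, `g ∈ U(V)(F)` (automorphically: one `π_f` in the `ℚ`-block, i.e. Hecke field `T = ℚ`, with
multiplicity one, so that `N ≅ π_f^Γ` is irreducible and `End_Hecke(N) = ℂ` by Schur). -/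
def IsSchurBlock (A : HodgeModel (2 * (m + 1)) X) (N : Submodule ℂ (complexBetti X (2 * (m + 1)))) : Prop :=
  N ≤ typePart A (2 * (m + 1)) (m + 1) (m + 1) ∧
    ∀ V : Submodule ℂ (complexBetti X (2 * (m + 1))), V ≤ N →
      (∀ (g : GL (Fin (2 * (m + 1) + 1)) D.E), ∀ v ∈ V, D.heckeCorrespondenceAction (2 * (m + 1)) g v ∈ V) →
        V = ⊥ ∨ V = N

end Conjugation

/-! ## The six registered stubs -/

/-- **Stub 1 — THE conjugation operator exists; Hodge types of the conjugate form subspaces (KNOWN in print;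
size L as a formalisation).** For `X` smooth projective over `ℂ` and `σ ∈ Aut ℂ`: (a) a `ConjugationOperator σ X`
exists — charts exist for every class (Jouanolou 1973 Lemme 1.5: an affine vector-bundle torsor `Y → X`, so
`π^*`, `(π^σ)^*` are isomorphisms; GAGA + de Rham: `Hᵏ(Y^an; ℂ)` is computed by closed algebraic forms,
Grothendieck 1966 Thm 1'), all charts agree and are single-valued (uniqueness of analytifications, naturality +
rational normalisation of the de Rham family, Grothendieck's comparison on `Y` — the pinning (a)–(c) recorded in
Disproof.lean finding 10), and the resulting `θ` is `σ`-semilinear (`conjugates_smul`, landed), additive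
(`conjugates_add`, landed), bijective (inverse = conjugation by `σ⁻¹`) and multiplicative (conjugation of
expressions is a ring map; cup product of forms); (b) `X^σ` is smooth projective of the same dimension
(`IsSmoothProjective.conjugateVariety`), so it has a Hodge model (`nonempty_hodgeModel`) and its classes of
type `(p,q)` in `Hᵏ` form a `ℂ`-subspace independent of the model (`hodgePQ_independent_of_hodgeModel`) — three
named facts of the tree. Why it might fail: not mathematically (Charles–Schnell §11.2.2; Deligne LNM 900 §2);
Lean-side it is the comparison-theorem package the whole predicate `IsAbsoluteHodgeClass` waits for.
Leans on: `ConjugationChart`, `IsConjugateClass`, `AlgFormExpr`, `IsAnalytification`, `ComplexDeRhamIsoFamily`,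
`HodgeModel`, `conjugates_add`/`conjugates_smul` (Negative/ChartConjugationUniqueness). -/
theorem stub_conjugationOperator : ∀ (d : ℕ) (X : SchemeOver ℂ), IsSmoothProjective d X →
    ∀ σ : ℂ ≃+* ℂ, Nonempty (ConjugationOperator σ X) ∧
      ∀ k a b : ℕ, ∃ V : Submodule ℂ (complexBetti (conjugateVariety σ X) k),
        ∀ x : complexBetti (conjugateVariety σ X) k, x ∈ V ↔ IsOfHodgeType d (conjugateVariety σ X) k a b x := by
  sorry

/-- **Stub 2 — the rational blocks exist (KNOWN in print; size M–L).** For every datum and degree the `ℚ`-algebra generated by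
the Hecke operators `T_g = D.heckeCorrespondenceAction k g` has a finite family of central primitive idempotents summing to `1` and
respecting Hodge types (`IsRationalBlocks`). Why plausibly true: the operators preserve the finite-dimensional `ℚ`-form
`Hᵏ(X(ℂ); ℚ)` (`isRationalClass_heckeCorrespondenceAction`; `X(ℂ)` is a compact manifold), so the algebra is a finite-dimensional
`ℚ`-algebra; it is semisimple because `T_g^* = T_{g⁻¹}` for the Petersson / Hodge inner product on harmonic forms (the two projections
of the Hecke correspondence are local isometries of the Bergman metric), hence its primitive central idempotents exist, are finite in
number, sum to `1`, and lie in the algebra; Hodge types: each `T_g = [Γ':N_g]⁻¹ π_* π_g^*` is induced by an ALGEBRAIC correspondence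
(finite étale projections), a morphism of Hodge structures of type `(0,0)` (BMM arXiv:1306.1515 Part 2 §1.8 "`ℋ_K` acts as algebraic
correspondences", Thm 61: the pieces are `ℚ`-sub-Hodge structures), and a `ℚ`-polynomial in such preserves every `typePart A k a b`.
Shared with the sibling line `hecke-simple-seed-amplification` (`stub_heckeCorrespondence` (i) + `stub_semisimple`). Why it might
fail: only through the rendering (admissibility `IsHeckeAdmissible g` of every `g ∈ U(V)(F)` — finite index + covering map — is the
consumer's obligation per the definition file; inadmissible `g` give `T_g = 0`, harmless here). Leans on:
`heckeCorrespondenceAction`, `levelProj_map_heckeCorrespondenceAction`, `isRationalClass_heckeCorrespondenceAction`,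
`IsHeckeAdmissible`, `FiniteDeckCover.transferMap`, `HodgeModel`, `IsSemisimpleRing`. -/
theorem stub_heckeBlocks : ∀ (p k : ℕ) (X : SchemeOver ℂ) (D : UnitaryBallQuotientDatum p X),
    ∃ (ι : Type) (_ : Fintype ι) (e : ι → Module.End ℂ (complexBetti X k)), IsRationalBlocks D k e := by
  sorry

/-- **Stub 3 — REFLEX DESCENT (KNOWN in print; size L–XL; card (F)).** For a datum `D` (so `X(ℂ) = Γ\𝔹²ⁿ` is a
connected component `S⁰` of the Shimura variety `Sh_{K_f}(GU(V))`, PEL type A) and the pinned Hecke family `T`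
there are a NUMBER FIELD `K ⊆ ℂ` and a `DescentDatum D T K`. Why plausibly true: `S⁰` has a canonical model over
the finite abelian extension `E_{K_f}` of the reflex field fixing the component (Shimura; Deligne, Variétés de
Shimura 2.7; BMM §1.2 "defined over `F^{ab}`"), giving `φ_σ` for `σ ∈ Aut(ℂ/E_{K_f})`; each classical Hecke
correspondence `C_β ⊂ S⁰ × S⁰` is the image of a connected component of a deeper Shimura variety under an
`E`-rational map, hence defined over a number field, and its `Aut(ℂ/E_{K_f})`-conjugates are among the finitely
many `C_{β'}`, `β' ∈ Γ\(G(ℚ) ∩ K_fβK_f)/Γ`; the rational Hecke algebra acting on the finite-dimensional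
`H²ⁿ(X(ℂ); ℚ)` is spanned by FINITELY many `T_{β₁}, …, T_{β_r}`, so over the compositum `K` of their fields of
definition (finite over `E_{K_f}`) EVERY `T_β = Σ qⱼ T_{βⱼ}` (`qⱼ ∈ ℚ`) commutes with `ι_σ = 1 ⊗ σ`,
`σ ∈ Aut(ℂ/K)` — field (i); field (ii) is the comparison of the Betti point class with the `K`-rational de Rham
class of a degree-one zero-cycle (factor `(2πi)^{-2n}`, any `K`-rational discrepancy being fixed by `σ`); field
(iii): an isomorphism of `ℂ`-varieties induces a homeomorphism of complex points holomorphic in algebraic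
coordinates, so it transports Hodge models. Why it might fail: mis-rendering only (e.g. if `IsOfHodgeType` could
not be transported along isomorphisms without `hodgePQ_independent_of_hodgeModel` — it can: push the model
forward); the conjugation theory of Shimura varieties is a theorem for all Shimura data (Milne–Shih 1982, Borovoi
1984, Milne 1983/1999) and classical here (PEL type A). Sources: Deligne 1979 §2.7; Milne–Shih
doi:10.1007/978-3-540-38955-2_7; Borovoi zbl:0555.32020; Kazhdan 1971/83 + Nori–Raghunathan zbl:0842.14014;
Deligne LNM 900 §1 (the `2πi`); Charles–Schnell Def. 11.2.3 footnote. Leans on: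
`nonempty_iso_conjugateVariety_baseChangeHom`, `Motives.baseChangeHom`, `complexBetti.map`, `periodTwist`,
`heckeCorrespondenceAction`, `HodgeModel`, `IsAnalytification`. -/
theorem stub_reflexDescent : ∀ (m : ℕ) (X : SchemeOver ℂ) (D : UnitaryBallQuotientDatum (2 * (m + 1)) X),
    ∃ (K : Subfield ℂ) (_ : NumberField K), Nonempty (DescentDatum D K) := by
  sorry

/-- **Stub 4 — INNER SCHUR RIGIDITY (THE LEVER; provable now in print from Stubs 1–3; size L; triage X2 of
r1-1, r1-2, r1-3).** Let `N = range (e i)` be a Schur block (pure `(n,n)`, Hecke-simple) and `σ ∈ Aut(ℂ/K)`. Then there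
is ONE sign `ε = ±1` such that for every RATIONAL `c ∈ N`: `θ_σ c = t_n · ε · φ_σ^* c`, `t_n = periodTwist σ n`.
Proof sketch: `s_σ := 1 ⊗ σ` on `H²ⁿ(X(ℂ); ℚ) ⊗ ℂ` (the tree's `singularCohomology.ringChange σ`) is
`σ`-semilinear, bijective, multiplicative, FIXES RATIONAL CLASSES and commutes with each `T_g` and with `e i`
(topological transfer/pull-back are natural in the coefficients); `ι_σ := (φ_σ^*)⁻¹ ∘ θ_σ` is `σ`-semilinear,
bijective, multiplicative (Stub 1 + `cupProduct_map`) and Hecke-commuting (Stub 3 (i)); so `L := ι_σ ∘ s_σ⁻¹` is a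
`ℂ`-LINEAR Hecke-commuting automorphism, preserves the rational block `N` (`e i` is a `ℚ`-polynomial in the `T_g`, `IsRationalBlocks.mem`),
and is a scalar `a` on the simple module `N` (Schur over `ℂ`); for rational `c ∈ N`, `ι_σ c = L c = a c`.
Polarisation: the rational block is SELF-DUAL for the cup pairing (`T_g^† = T_{g⁻¹}` for the Poincaré pairing —
transfer/pull-back adjointness — and the `ℚ`-block of `π_f` contains `π_f^∨ ≅ π̄_f`, a coefficient-conjugate), so
`Q(e x, (1-e) y) = 0` and Poincaré duality (`nonempty_singularCohomology_top_equiv_holds`,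
`bijective_poincareDualityMap_of_isSmoothProjective`) give RATIONAL `c₁, c₂ ∈ N_ℚ` with `c₁ ∪ c₂ = q η`,
`q ∈ ℚˣ`, `η` the rational top generator (a sub-Hodge structure alone would not suffice: isotropic Hodge lines
exist); apply `ι_σ` (multiplicative, Stub 3 (ii)): `a² q η = q t_{2n} η`, so `a² = t_{2n} = t_n²`, `a = ε t_n`
(`N` is finite-dimensional — compact manifold — so Schur applies over `ℂ`). Hence `θ_σ c = φ_σ^*(ε t_n c)`.
RATIONALITY is used exactly at `ι_σ c = L c`. Why it might fail: only by mis-rendering of the scope (e.g. a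
Hecke-simple block on the component that is not `π_f^Γ`-irreducible for the genuine operators `T_g`
— then it is simply not a Schur block and falls to Stub 6); the statement for genuine Schur blocks is a theorem in
print (triage r1-3 "cross-card fact 2"). Leans on: `singularCohomology.ringChange`, `ringChange_cupProduct`,
`isRationalClass_iff_exists_ringChange`, `cupProduct_map`, `bijective_poincareDualityMap_of_isSmoothProjective`,
`Module.End.exists_eigenvalue` (Schur over `ℂ`), `IsRationalBlocks`, `DescentDatum`. -/
theorem stub_innerSchur : ∀ (m : ℕ) (X : SchemeOver ℂ) (D : UnitaryBallQuotientDatum (2 * (m + 1)) X)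
    (ι : Type) [Fintype ι] (e : ι → Module.End ℂ (complexBetti X (2 * (m + 1)))),
    IsRationalBlocks D (2 * (m + 1)) e →
    ∀ (K : Subfield ℂ) [NumberField K] (R : DescentDatum D K) (σ : ℂ ≃+* ℂ) (hσ : ∀ x ∈ K, σ x = x)
      (Θ : ConjugationOperator σ X) (A : HodgeModel (2 * (m + 1)) X) (i : ι),
      IsSchurBlock D A (LinearMap.range (e i)) →
      ∃ ε : ℚ, (ε = 1 ∨ ε = -1) ∧
        ∀ c : complexBetti X (2 * (m + 1)), IsRationalClass c → c ∈ LinearMap.range (e i) →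
          Θ.θ (2 * (m + 1)) c =
            periodTwist σ (m + 1) • ((ε : ℂ) • complexBetti.map (R.iso σ hσ).hom (2 * (m + 1)) c) := by
  sorry

/-- **Stub 5 — OUTER SQUARE CLASS IS TRIVIAL (BET 1; open; its weak form is provable; size XL).** Let `N` be a
Schur block, `K` the number field of the descent datum and `σ` NOT in `Aut(ℂ/K)` (finitely many classes
`σ|_K`). Then there is a `ℂ`-linear `ψ : H²ⁿ(X) → H²ⁿ(X^σ)` carrying rational classes to rational classes and
`(n,n)`-classes to `(n,n)`-classes with `θ_σ c = t_n ψ c` for every rational `c ∈ N`. What is PROVABLE (to be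
recorded by the prover as the first half): `X^σ` is again a compact arithmetic ball quotient with conjugate datum
(Kazhdan; Langlands' conjugation of Shimura varieties — Milne–Shih, Borovoi, Milne), `θ_σ` intertwines `T_β` with
the conjugate correspondence `T_β^σ`, so `N' := θ_σ(N)` is the complexification of the RATIONAL block
`e^σ H²ⁿ(X^σ, ℚ)`, again pure `(n,n)` (`θ` preserves `Fⁿ`, `N'` is real) and Hecke-simple; Noether–Deuring +
Schur: `Hom_Hecke(N, N') = ℂ · ψ₀` with `ψ₀ : N_ℚ ≅ N'_ℚ` rational, so `θ_σ c = μ ψ₀(c)` for rational `c`, and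
self-cup + Stub 3-type top normalisation on `X^σ` give `μ² = t_n² r`, `r = Q(c₁,c₁)/Q'(ψ₀c₁,ψ₀c₁) ∈ ℚˣ`: the block
is WEAKLY absolute Hodge for every `σ` (`t = ±√r` algebraic; Disproof §5 `weakly_of` direction reversed). What is
the BET: the square class `r_σ(N) ∈ ℚˣ/ℚˣ²` (for `dim N` odd: `disc N ≡ disc N'`) is trivial — then
`ψ := ±√r · ψ₀` is rational and the stub holds; killed by ONE detecting algebraic class (a seed, card
`hecke-simple-seed-amplification`; a detecting special divisor, card `cup-period-bootstrap`; theta, route B1).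
Selection compatibility [Sel] (`χ₀` selected on `X` ⇒ `χ₀^σ` selected on `X^σ`: a root-number identity between
inner forms) is the automorphic input for purity of `N'`. Why it might fail: `r_σ(N)` non-square for one Schur
block of one compact `U(2n,1)`-quotient = a Hodge class that is not absolute Hodge = ¬HC (Disproof §2
`not_hodgeConjecture_of_not`); no such example is known. Leans on: `ConjugationOperator`, `IsSchurBlock`,
`IsRationalClass.map`, Barriers `ConjugateVarietiesProofs.nonempty_iso_conjugateVariety_baseChangeHom`; print:
Milne–Shih 1982, Blasius–Harris–Ramakrishnan Duke 73 (1994) (`π_f ↦ σπ_f` on cohomology), Deligne LNM 900 §2. -/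
theorem stub_outerSquareClass : ∀ (m : ℕ) (X : SchemeOver ℂ) (D : UnitaryBallQuotientDatum (2 * (m + 1)) X)
    (ι : Type) [Fintype ι] (e : ι → Module.End ℂ (complexBetti X (2 * (m + 1)))),
    IsRationalBlocks D (2 * (m + 1)) e →
    ∀ (K : Subfield ℂ) [NumberField K] (R : DescentDatum D K) (σ : ℂ ≃+* ℂ), (∃ x ∈ K, σ x ≠ x) →
      ∀ (Θ : ConjugationOperator σ X) (A : HodgeModel (2 * (m + 1)) X) (i : ι),
      IsSchurBlock D A (LinearMap.range (e i)) →
      ∃ ψ : complexBetti X (2 * (m + 1)) →ₗ[ℂ] complexBetti (conjugateVariety σ X) (2 * (m + 1)),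
        (∀ x : complexBetti X (2 * (m + 1)), IsRationalClass x → IsRationalClass (ψ x)) ∧
        (∀ x : complexBetti X (2 * (m + 1)), IsOfHodgeType (2 * (m + 1)) X (2 * (m + 1)) (m + 1) (m + 1) x →
          IsOfHodgeType (2 * (m + 1)) (conjugateVariety σ X) (2 * (m + 1)) (m + 1) (m + 1) (ψ x)) ∧
        ∀ c : complexBetti X (2 * (m + 1)), IsRationalClass c → c ∈ LinearMap.range (e i) →
          Θ.θ (2 * (m + 1)) c = periodTwist σ (m + 1) • ψ c := by
  sorry

/-- **Stub 6 — THE RESIDUAL BLOCKS (BET 2; HARDEST; the residue shared by all eight cards of the panel; size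
open-problem).** For a block `N = range (e i)` that is NOT a Schur block, every `σ`, and every rational
`(n,n)`-class `c`: the conjugate of the component `e i c` is `t_n ·` a rational `(n,n)`-class of `X^σ`.
Taxonomy (for the prover; each line a separate sub-target): (R1) `N` IMPURE. (R1a) KILLED blocks (some
conjugate block carries no `(n,n)` at all): `e i c = 0` for rational `c` by the conjugate-dimension sieve
(sibling line `conjugate-dimension-sieve`, `stub_sieve`: PROVABLE, coefficient conjugation only) — then
`θ 0 = 0`. (R1b) CORES (every conjugate block carries `(n,n)` next to other types: a constituent of rank `≥ 2`
owning the middle weight at every embedding — `Ψ₅` stable, `Ψ₄ ∋ 0`, `3+2`, `2+2+1`, … at `n = 2`, triage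
r1-2 X1): expected `e i c = 0` (HC + Tate + irreducibility of `r(Ψ)`: Blasius–Rogawski rank 3, Calegari–Gee /
Xia `n ≤ 5`, Patrikis–Taylor density one), tool-less today; ONE rational `(n,n)`-class in ONE core of ONE compact
`U(2n,1)`-quotient that is not absolute Hodge refutes the stub AND the Hodge conjecture. (R2) `N` PURE but not
Hecke-simple (Hecke field `T ≠ ℚ`, or multiplicity `> 1`, or self-twists `π_f ≅ π_f ⊗ χ∘det` on the component):
the comparison `L_σ = ι_σ s_σ⁻¹` lies in the commutant `C = End_Hecke(N)` and duality puts `L_σ/t_n` in its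
norm-one group `U(C, †)` (card (C): `σ ↦ L_σ/t_n` is a 1-cocycle of `Aut(ℂ/K)` with values in `U(C)(ℂ)`,
absoluteness ⟺ values in `C_ℚˣ`); for `T` totally real with multiplicity one `U(C)(ℂ) = {±1}^{Hom(T,ℝ)}` is
FINITE, the cocycle is trivialised on `Aut(ℂ/K')` for a finite extension `K'`, and the argument of Stub 4 then
proves the inner clause on `N` verbatim (provable sub-case); for CM `T` the phase is the honest open period
content (Blasius 1986 / Harris 1997 give the modulus only). At `m = 0` (surfaces) the whole stub follows in print
from Lefschetz (1,1) + cycle classes absolute Hodge (Disproof §3 `atLevel_zero_of_lefschetz`). Why it might fail: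
only together with HC (Disproof §2); the cheapest conceivable witness is an even core `4+1`, `Ψ₄ ∋ 0`, on a
compact `U(4,1)`-quotient. Leans on: `ConjugationOperator`, `typePart`, `IsRationalBlocks`; print: Arthur/Mok
arXiv:1206.0882, KMSW arXiv:1409.3731, Kisin–Shin–Zhu arXiv:2110.05381, Patrikis–Taylor arXiv:1307.1640,
Blasius–Rogawski zbl:0828.14012. -/
theorem stub_residualBlocks : ∀ (m : ℕ) (X : SchemeOver ℂ) (D : UnitaryBallQuotientDatum (2 * (m + 1)) X)
    (ι : Type) [Fintype ι] (e : ι → Module.End ℂ (complexBetti X (2 * (m + 1)))),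
    IsRationalBlocks D (2 * (m + 1)) e →
    ∀ (σ : ℂ ≃+* ℂ) (Θ : ConjugationOperator σ X) (A : HodgeModel (2 * (m + 1)) X) (i : ι),
      ¬ IsSchurBlock D A (LinearMap.range (e i)) →
      ∀ c : complexBetti X (2 * (m + 1)), IsRationalClass c → c ∈ typePart A (2 * (m + 1)) (m + 1) (m + 1) →
        ∃ β : complexBetti (conjugateVariety σ X) (2 * (m + 1)), IsRationalClass β ∧
          IsOfHodgeType (2 * (m + 1)) (conjugateVariety σ X) (2 * (m + 1)) (m + 1) (m + 1) β ∧
          Θ.θ (2 * (m + 1)) (e i c) = periodTwist σ (m + 1) • β := by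
  sorry

/-! ## The composition (kernel-checked; no `sorry` of its own) -/

/-- **`BallQuotientHodgeAbsolute` from the six stubs.** For `c` rational of type `(n,n)` and `σ ∈ Aut ℂ`:
Stub 1 gives THE conjugation operator `θ` (existence of a conjugate; every conjugate equals `θ c`) and the
subspace `V` of `(n,n)`-classes of `X^σ`; Stub 2 the rational blocks `eᵢ` of the Hecke algebra
(`Σ eᵢ = 1`, each `eᵢ c` rational of type `(n,n)`); Stub 3 the descent datum over a number field `K`. Per block:
Schur block and `σ ∈ Aut(ℂ/K)` ⇒ Stub 4, `βᵢ = ε φ_σ^*(eᵢ c)` (rational: pull-back along a morphism of varieties;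
in `V`: the datum transports Hodge types); Schur block and `σ ∉ Aut(ℂ/K)` ⇒ Stub 5, `βᵢ = ψ(eᵢ c)`; otherwise Stub 6.
Then `θ c = θ(Σ eᵢ c) = Σ θ(eᵢ c) = t_n · Σ βᵢ`, and `Σ βᵢ` is rational (rational classes add) and lies in `V`. -/
theorem BallQuotientHodgeAbsolute_of :
    Summit.HodgeConjecture.HodgeConjecture.Theses.EndoscopicMiddleDegree.BallQuotientHodgeAbsolute := by
  intro m X hD c hc hH
  obtain ⟨D⟩ := hD
  refine ⟨hc, hH, fun σ ↦ ?_⟩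
  -- Stub 1: THE conjugation operator, and the `(n,n)`-subspace of the conjugate variety
  obtain ⟨⟨Θ⟩, hV⟩ := stub_conjugationOperator (2 * (m + 1)) X D.isSmoothProjective σ
  obtain ⟨V, hVmem⟩ := hV (2 * (m + 1)) (m + 1) (m + 1)
  refine ⟨⟨Θ.θ (2 * (m + 1)) c, (Θ.conjugates_iff _ c _).2 rfl⟩, fun c' hc' ↦ ?_⟩
  have hc'eq : c' = Θ.θ (2 * (m + 1)) c := (Θ.conjugates_iff _ c c').1 hc'
  subst hc'eq
  -- Stub 2: the rational blocks of the Hecke algebra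
  obtain ⟨ι, hι, e, he⟩ := stub_heckeBlocks (2 * (m + 1)) (2 * (m + 1)) X D
  -- Stub 3: reflex descent over a number field `K`
  obtain ⟨K, hK, ⟨R⟩⟩ := stub_reflexDescent m X D
  -- the Hodge model in which `c` is read
  obtain ⟨A, hA⟩ := hH
  have hcA : c ∈ typePart A (2 * (m + 1)) (m + 1) (m + 1) := hA
  -- blockwise conjugates
  have key : ∀ i : ι, ∃ β : complexBetti (conjugateVariety σ X) (2 * (m + 1)),
      IsRationalClass β ∧ β ∈ V ∧ Θ.θ (2 * (m + 1)) (e i c) = periodTwist σ (m + 1) • β := by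
    intro i
    have hrat : IsRationalClass (e i c) := he.rational i hc
    have htyp : e i c ∈ typePart A (2 * (m + 1)) (m + 1) (m + 1) := he.hodgeType i A (m + 1) (m + 1) c hcA
    have hmem : e i c ∈ LinearMap.range (e i) := LinearMap.mem_range_self (e i) c
    by_cases hS : IsSchurBlock D A (LinearMap.range (e i))
    · by_cases hσ : ∀ x ∈ K, σ x = x
      · -- Stub 4: inner Schur rigidity
        obtain ⟨ε, -, hε⟩ := stub_innerSchur m X D ι e he K R σ hσ Θ A i hS
        refine ⟨(ε : ℂ) • complexBetti.map (R.iso σ hσ).hom (2 * (m + 1)) (e i c), ?_, ?_, hε _ hrat hmem⟩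
        · exact (IsRationalClass.map _ hrat).smul ε
        · exact V.smul_mem _ ((hVmem _).2 (R.hodgeType σ hσ (e i c) ⟨A, htyp⟩))
      · -- Stub 5: outer square class
        have hσ' : ∃ x ∈ K, σ x ≠ x := by
          by_contra h'
          exact hσ fun x hx ↦ by_contra fun hne ↦ h' ⟨x, hx, hne⟩
        obtain ⟨ψ, hψrat, hψtyp, hψ⟩ := stub_outerSquareClass m X D ι e he K R σ hσ' Θ A i hS
        exact ⟨ψ (e i c), hψrat _ hrat, (hVmem _).2 (hψtyp _ ⟨A, htyp⟩), hψ _ hrat hmem⟩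
    · -- Stub 6: the residual blocks
      obtain ⟨β, hβ, hβtyp, h⟩ := stub_residualBlocks m X D ι e he σ Θ A i hS c hc hcA
      exact ⟨β, hβ, (hVmem _).2 hβtyp, h⟩
  choose β hβrat hβV hβeq using key
  refine ⟨∑ i, β i, ?_, (hVmem _).1 (V.sum_mem fun i _ ↦ hβV i), ?_⟩
  · exact Finset.sum_induction _ _ (fun a b ha hb ↦ ha.add hb) IsRationalClass.zero fun i _ ↦ hβrat i
  · have hsum : (∑ i, e i c) = c := by
      have h := LinearMap.congr_fun he.sum c
      rw [LinearMap.sum_apply] at h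
      simpa using h
    calc Θ.θ (2 * (m + 1)) c = Θ.θ (2 * (m + 1)) (∑ i, e i c) := by rw [hsum]
      _ = ∑ i, Θ.θ (2 * (m + 1)) (e i c) := map_sum _ _ _
      _ = ∑ i, periodTwist σ (m + 1) • β i := Finset.sum_congr rfl fun i _ ↦ hβeq i
      _ = periodTwist σ (m + 1) • ∑ i, β i := Finset.smul_sum.symm

end Summit.HodgeConjecture.HodgeConjecture.Cruxes.BallQuotientHodgeAbsolute.ReflexDescentConjugationCocycle

end
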